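import Summits.BirchSwinnertonDyer.Rank1Residual.X10.SurjThreePerPairKernelImage
import Summits.BirchSwinnertonDyer.Rank1Residual.X10.MuTransferThreeOfFineShaCells
import HarnessLib

/-!
# Row D3 ∩ {r = 0}: the Ш-CELLS (good ordinary at `3`, `ρ̄_{E,3}` SURJECTIVE, `L(E,1) ≠ 0`, `9 ∣ #Ш_an`) PER PAIR,
# FLAG-FREE and F1-FREE — Miller's `BSD(E,3)` from Wuthrich 2014 Prop. 21 (UPPER half) + ONE exact `3`-descent
# `#Sel^(3)(E/ℚ) = 9` (LOWER half) + the mod-`3` image DECIDED IN THE KERNEL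
# (cell `b2b-bsdres`, unit `b2b-bsdres-x10` = X10 / N2 class lead, GEN 42; TOOL — theorems only, no definition, no named
# fact, nothing booked)

HONEST FRAMING (run/shared/lean/b2b/bsd-rank1-residual/, verbatim in every file): the goal of the
cell is to DELETE the COMBINATION-SHAPED residual classes of the Birch–Swinnerton-Dyer formula for
ALL analytic-rank `≤ 1` elliptic curves over `ℚ` — "full BSD formula for every rank `≤ 1` curve in
class `C`" assembled STRICTLY from published theorems — so that the rank-`≤ 1` remainder becomes
exactly the CONSTRUCTION-SHAPED classes, which are TYPED (missing-input `Prop`s), NOT attempted.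
This is not "finishing BSD".  X10a′ = X10 ∧ surj(3) is CLOSED (PUB*) AS A CLASS by Yan–Zhu 2026 Thm. 4.15 under
the register flag `YZ26@3-BF-ERL-Ohta` (row D3); THIS FILE books nothing and touches no class statement.
PARTITION (D-0054): D3 / X10a′ × p = 3 × r = 0 × 9 ∣ #Ш_an — types-the-object-of; closes NONE.

## What (x10 GEN 42, X10-AUDIT §48)

The census of this gen (`class-closure/N2/D3R0-CANDIDATES-x10g42.tsv`): of the 5 437 classes carrying `('YZ26', 3)`,
179 have analytic rank `0` — and EVERY ONE of them is a Ш-cell (`#Ш_an ∈ {9, 36, 81}`: 174 / 3 / 2), good ordinary at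
`3` with `ρ̄_{E,3}` onto; the rank-`0` cells with `3 ∤ #Ш_an` left the flag long ago by Wuthrich's Prop. 21 alone.
So the per-pair road for D3 ∩ {r = 0} is the Ш-cell road, and it needs NO Iwasawa theory at all:

* `bsdp_three_rankZero_surj_shaCell_of_wuthrich_of_card_selmerThree` — `3` good, `ρ̄_{E,3}` onto, `L(E,1) ≠ 0`,
  `ord₃ #Ш_an ≤ 2`: Wuthrich 2014 Prop. 21 (`hW`, A6: `ord₃ #Ш ≤ ord₃ #Ш_an`, the printed one-sided bound at an odd
  non-additive prime with surjective or reducible image — inlined from x11b's `Typed.missingUpperBoundAt_of_wuthrich`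
  so that `L(E,1) ≠ 0` is used directly and the only modularity binder is the cell's usual `hmodP`) + ONE exact
  `3`-descent `hcard : #Sel^(3)(E/ℚ) = 9` (GEN 41's `missingLowerBoundAt_three_of_card_selmerThree`: at rank `0`
  with `E[3]` irreducible `#(Ш ⊓ H¹(ℚ,E)[3]) = #Sel^(3)`, Silverman X.4.2 (a), so `9 ∣ #Ш`) + GZK (A18) + `hmodP`
  (A19) ⟹ Miller's `BSD(E,3)`.  NO Kato, NO F1, NO `μ`-certificate, NO Cassels–Tate, NO Yan–Zhu; FLAG-FREE.
* `MuZeroRoad.bsdp_three_rankZero_shaCell_of_ainvs_of_surjWitnesses_of_wuthrich_of_card_selmerThree` — the record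
  shape off a literal integer model with good reduction at `3` AND surjectivity DECIDED IN THE KERNEL
  (`MuZeroRoad.surj_three_of_ainvs_of_witnesses`: an irreducibility witness `ℓ₁` and a transvection witness `ℓ₂`);
  displayed: `hW` (A6), `hGZK` (A18), `hmodP` (A19); census `hL`, `hq`/`hv` (`ord₃ #Ш_an = 2`); certificate
  `hcard` (one two-engine exact `3`-descent — units x11b `desc3lib.gp` / x10b `desc3full_e2.py`, both made for
  exactly this one-orbit case).

References: C. Wuthrich, Doc. Math. 19 (2014) Prop. 21 [Wuthrich2014]; J. H. Silverman, AEC (2009) Thm. X.4.2 (a),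
VII.3.1 (b), VII.4.1 (a) [SilvermanAEC2009]; J.-P. Serre, Invent. Math. 15 (1972) §2.4 Prop. 15, §2.8 [Serre1972];
E. F. Schaefer, M. Stoll, Trans. AMS 356 (2004) [SchaeferStoll2004] (the descent realising `hcard`); R. L. Miller,
LMS J. Comput. Math. 14 (2011) Def. 1.1 [Miller2011LMS].
-/

set_option autoImplicit false

noncomputable section

open scoped Classical MatrixGroups ModularForm

open CongruenceSubgroup WeierstrassCurve Field Literature.NumberTheory.GaloisRepresentations
  Literature.NumberTheory.GaloisCohomology Literature.NumberTheory.EllipticCurves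
  Literature.NumberTheory.EllipticCurves.ModularForms Literature.NumberTheory.EllipticCurves.Rank1Residual
  Literature.NumberTheory.EllipticCurves.Rank1Residual.Typed
  Literature.NumberTheory.EllipticCurves.Wuthrich2014
  Literature.NumberTheory.EllipticCurves.Rank1Residual.X11RankOneCertificates
  Summit.BirchSwinnertonDyer.BirchSwinnertonDyer.Rank1Residual.IntModel
  Summit.BirchSwinnertonDyer.BirchSwinnertonDyer.Rank1Residual.X11RankOne
  Summit.BirchSwinnertonDyer.BirchSwinnertonDyer.Theorems.Rank1ResidualX1Defs
  Summit.BirchSwinnertonDyer.BirchSwinnertonDyer.Rank1Residual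

namespace Summit.BirchSwinnertonDyer.Rank1Residual.X10

section ShaCell

variable (W : WeierstrassCurve ℚ) [W.IsElliptic] [W.IsGloballyMinimal]

/-- **D3 ∩ {r = 0} Ш-cell per pair, FLAG-FREE: `3` good, `ρ̄_{E,3}` onto, `L(E,1) ≠ 0`, `ord₃ #Ш(E/ℚ)_an ≤ 2`:
Wuthrich 2014 Prop. 21 ∧ ONE exact `3`-descent `#Sel^(3)(E/ℚ) = 9` ⟹ Miller's `BSD(E,3)`.**  UPPER half
`ord₃ #Ш ≤ ord₃ #Ш_an` = Prop. 21 (`padicValNat_shaOrder_le_of_sha_dvd`, `E(ℚ)`/`Ш` finite by GZK at analytic rank `0`,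
non-additive from good, image clause by `hsurj`; `#Ш_an` identified by `shaAn_eq_of_L_one_div_eq`); LOWER half
`2 ≤ ord₃ #Ш` from `hcard` (`missingLowerBoundAt_three_of_card_selmerThree`, Silverman X.4.2 (a); `E[3]` irreducible
from `hsurj`).  Binders: PUBLISHED `hW` (A6), `hGZK` (A18), `hmodP` (A19, only to read `L(E,1) ≠ 0` as analytic rank `0`);
data `hgood`, `hsurj`, `hL`, `hq`/`hv`; certificate `hcard`.  NO Kato / F1 / `μ`-certificate / Cassels–Tate / Yan–Zhu.
Per pair; nothing booked. [cite: Wuthrich2014, Prop. 21 (p. 400)] [cite: SilvermanAEC2009, Thm. X.4.2 (a)]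
[cite: Miller2011LMS, Def. 1.1 (arXiv:1010.2431 p. 3)] -/
theorem bsdp_three_rankZero_surj_shaCell_of_wuthrich_of_card_selmerThree (hW : Wuthrich2014.sha_dvd_analyticSha)
    (hGZK : rank_eq_analyticRank_of_analyticRank_le_one) (hmodP : nonempty_modularParametrizationData)
    (hgood : W.HasGoodReductionAtPrime 3) (hsurj : Surj W 3) (hL : W.entireLFunction 1 ≠ 0)
    (hcard : Nat.card (W.selmerGroup (3 : ℤ)) = 9)
    {q : ℚ} (hq : shaAn W = (q : ℂ)) (hv : padicValRat 3 q ≤ 2) : BSDp W 3 := by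
  haveI : Fact (Nat.Prime 3) := ⟨by norm_num⟩
  haveI : NeZero (W.conductorNorm ℤ) := ⟨(W.conductorNorm_pos_holds).ne'⟩
  obtain ⟨Dm⟩ := hmodP W
  have hr0 : W.analyticRank = 0 :=
    (W.analyticRank_eq_zero_iff_holds Dm.isNewformOf.hasEntireLFunction).mpr hL
  have hirr : W.HasIrreducibleModPGaloisRep 3 :=
    hasIrreducibleModPGaloisRep_of_hasSurjectiveModNGaloisRep W 3 hsurj
  -- UPPER half: Wuthrich Prop. 21 (the proof of `Typed.missingUpperBoundAt_of_wuthrich`, with `hL` in hand)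
  have hup : Typed.MissingUpperBoundAt W 3 := by
    obtain ⟨hrank, hfin⟩ := hGZK W (by omega)
    have hmw0 : W.mordellWeilRank = 0 := by omega
    haveI hE : Finite W.toAffine.Point := W.finite_point_of_rank_zero hmw0
    obtain ⟨q', hq', -, hle⟩ := padicValNat_shaOrder_le_of_sha_dvd hW W 3 (by norm_num) hL hE hfin
      (WeierstrassCurve.HasGoodReduction.not_hasAdditiveReduction _ hgood) (Or.inr hsurj)
    obtain ⟨-, -, -, hshaAn⟩ := shaAn_eq_of_L_one_div_eq hGZK W hL hq'
    exact ⟨_, hshaAn, hle⟩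
  exact bsdp_of_missingPPartAt W 3 hGZK (by rw [hr0]; exact Nat.zero_le _)
    (missingPPartAt_of_lower_of_upper W 3
      (missingLowerBoundAt_three_of_card_selmerThree W hGZK hirr hr0 hcard hq hv) hup)

end ShaCell

namespace MuZeroRoad

/-- **D3 ∩ {r = 0} Ш-cell record shape with the IMAGE DECIDED IN THE KERNEL: Wuthrich Prop. 21 ∧ `#Sel^(3)(E/ℚ) = 9` ∧
`L(E,1) ≠ 0` ∧ `ord₃ #Ш_an ≤ 2` ⟹ Miller's `BSD(E,3)` for a cell given by a literal integer model** — good reduction at `3`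
from `3 ∤ Δ`; `ρ̄_{E,3}` onto from the two Frobenius witnesses of `surj_three_of_ainvs_of_witnesses` (`ℓ₁`: irreducible
characteristic polynomial mod `3`; `ℓ₂ ≡ 1`, `a_{ℓ₂} ≡ 2 (mod 3)`, `9 ∤ #Ẽ(𝔽_{ℓ₂})`: a transvection); displayed:
PUBLISHED `hW` (A6), `hGZK` (A18), `hmodP` (A19); census `hL`, `hq`/`hv`; certificate `hcard` (ONE two-engine exact
`3`-descent).  FLAG-FREE, F1-FREE; per pair; nothing booked. [cite: Wuthrich2014, Prop. 21 (p. 400)]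
[cite: SilvermanAEC2009, Thm. X.4.2 (a)] [cite: Serre1972, §2.4 Prop. 15, §2.8]
[cite: Miller2011LMS, Def. 1.1 (arXiv:1010.2431 p. 3)] -/
theorem bsdp_three_rankZero_shaCell_of_ainvs_of_surjWitnesses_of_wuthrich_of_card_selmerThree
    (hWu : Wuthrich2014.sha_dvd_analyticSha) (hGZK : rank_eq_analyticRank_of_analyticRank_le_one)
    (hmodP : nonempty_modularParametrizationData)
    (a1 a2 a3 a4 a6 : ℤ) {W : WeierstrassCurve ℚ} [W.IsElliptic] [W.IsGloballyMinimal]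
    (hW : integralModelInt W = ⟨a1, a2, a3, a4, a6⟩)
    (ℓ₁ n₁ ℓ₂ n₂ : ℕ) [Fact ℓ₁.Prime] [Fact ℓ₂.Prime]
    (h3Δ : ¬ (3 : ℤ) ∣ discOf [a1, a2, a3, a4, a6])
    (hℓ₁2 : ℓ₁ ≠ 2) (hℓ₁3 : ℓ₁ ≠ 3) (hℓ₁Δ : ¬ (ℓ₁ : ℤ) ∣ discOf [a1, a2, a3, a4, a6])
    (hc₁ : countPoints [a1, a2, a3, a4, a6] ℓ₁ = n₁)
    (hnoroot : ∀ t : ℕ, t < 3 → ¬ (3 : ℤ) ∣ (t : ℤ) ^ 2 - ((ℓ₁ : ℤ) + 1 - n₁) * t + ℓ₁)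
    (hℓ₂2 : ℓ₂ ≠ 2) (hℓ₂3 : ℓ₂ ≠ 3) (hℓ₂Δ : ¬ (ℓ₂ : ℤ) ∣ discOf [a1, a2, a3, a4, a6])
    (hc₂ : countPoints [a1, a2, a3, a4, a6] ℓ₂ = n₂)
    (hdet₂ : (ℓ₂ : ZMod 3) = 1) (htr₂ : (((ℓ₂ : ℤ) + 1 - n₂ : ℤ) : ZMod 3) = 2) (hsq : ¬ 9 ∣ n₂)
    (hL : W.entireLFunction 1 ≠ 0)
    (hcard : Nat.card (W.selmerGroup (3 : ℤ)) = 9)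
    {q : ℚ} (hq : shaAn W = (q : ℂ)) (hv : padicValRat 3 q ≤ 2) : BSDp W 3 := by
  haveI : Fact (Nat.Prime 3) := ⟨by norm_num⟩
  have hgood : W.HasGoodReductionAtPrime 3 :=
    hasGoodReductionAtPrime_of_not_dvd W 3 (by rw [minimalDiscriminantInt_eq hW, intCurve_Δ]; exact h3Δ)
  exact bsdp_three_rankZero_surj_shaCell_of_wuthrich_of_card_selmerThree W hWu hGZK hmodP hgood
    (surj_three_of_ainvs_of_witnesses a1 a2 a3 a4 a6 hW ℓ₁ n₁ ℓ₂ n₂ hℓ₁2 hℓ₁3 hℓ₁Δ hc₁ hnoroot hℓ₂2 hℓ₂3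
      hℓ₂Δ hc₂ hdet₂ htr₂ hsq) hL hcard hq hv

end MuZeroRoad

end Summit.BirchSwinnertonDyer.Rank1Residual.X10

end
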